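import Summits.QuantumFields.BalabanUV.T4Continuum.Spine.NE1p.DressedSmallFieldFamilyCountFaces

/-!
# T⁴ programme, spine estimate NE1′ (node O3b/H2) — THE FAMILIES END OF N0s WITHOUT A RADIUS BINDER AND WITHOUT A GEOMETRY
# HYPOTHESIS AT EITHER SCALE: `attachedPart_locE_le_of_coresAt_pencil_families` ((B3-count) DISCHARGED by b13's PROVED (2.29)) ϱ-free
# over a `B13Resummation.Geometry` (N0m §4b's SHARP room 3), and on pv22's tori with located numerals at BOTH sockets — step geometry
# `tgeometry 4 N`, scale-`k` geometry `tgeometry 4 M` — with the count `count_coveringFamilies_geometry` itself located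
# (PART 2 of the N0s faces; PART 1 `DressedSmallFieldFamilyCountFaces` = the three count-split ENDs of N0s §3∕§3b on the torus)

Cell `pub-balaban`, sub-cell `t4`, BINDER-OWNERS row NE1′ (owner lineage t4-ne1p-p1); crew seat `b2b-balaban-t4-ne1p-formalise-leaf-05`
(LEAF PROVER 05, generation 11); crew FACE row S34 ∕ DAG N29zze, PART 2 (INTENT `CLAIMS.log` 2026-08-20 l.18618, BOOKED typer R-T124 (ii);
R-T102 (i)'s invariant).  ADDITIVE — imports
PART 1 `Spine/NE1p/DressedSmallFieldFamilyCountFaces` ONLY (⇒ the owner's N0s `DressedSmallFieldFamilyCount` ⇒ N0r ⇒ N0q ⇒ N0p ⇒ N0o ⇒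
N0m v1.2, crew row S24 `DressedSmallFieldGeometryFaces`, b13's `B13FamilySum` and pv22's `TreeLengthTorusGeometry` in the cone);
THEOREMS ONLY (+ two `example`s; 0 `def`, 0 `def … : Prop`); nothing of N0s ∕ N0r ∕ N0q ∕ N0p ∕ N0o ∕ N0m ∕ S24–S29 ∕ PART 1 ∕ the substrate ∕
row NE5 ∕ b13 ∕ pv22 restated — their declarations are used BY NAME.

WHY THIS FILE.  N0s §4 `attachedPart_locE_le_of_coresAt_pencil_families` indexes the terms of a polymer `Z` by COVERING FAMILIES `𝐃`
of scale-`k` domains and DISCHARGES (B3-count) by b13's PROVED (2.29) (`B13FamilySum.ineq229_locDomainSys`, through N0s §2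
`count_coveringFamilies_geometry`).  It keeps (i) the step geometry `G : Geometry D Cube` with the clauses at `G`'s letters
(`hrate : r₁ + 2·G.κ₀ + 2 ≤ R`, `hsmall : (A₀ + ϱA₁)·e^{b₅+1}·G.K₀·G.ν·G.c₁ ≤ 1`), (ii) N0m §2's radius conditions `hϱ : 2 ≤ ϱ`,
`hϱA : A₀ ≤ ϱ·A₁`, and (iii) a SECOND socket, the scale-`k` geometry `Gk : Geometry Dk CubeK`, whose letters carry (2.29)'s
order-of-choice clauses `hκ : Gk.κ₀ + 1 ≤ δκ` («κ sufficiently large», [Balaban1988RGII] p. 18) and `h229 : e·Gk.K₀·Gk.c₁·α₆ ≤ 1`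
(«α₆ sufficiently small»).  THIS FILE gives the families END its faces — the S25–S29 pattern verbatim — and locates the second socket:
* §1 over ONE `G` (and an abstract `Gk`): `attachedPart_locE_le_of_coresAt_pencil_families_printClause_three` — N0s §4 at the pencil
  radius `ϱ⋆ := max 2 (A₀/A₁)` with `hϱ` ∕ `hϱA` ∕ `hsmall` SUPPLIED BY NAME by N0m's `two_le_pencilRadius` ∕ `intercept_le_pencilRadius_mul`
  ∕ `pencilClause_of_printClause_three` under a live slope `0 < A₁ ≤ A₀` and `h3 : 3·A₀·(e^{b₅+1}·G.K₀·G.ν·G.c₁) ≤ 1`; the class radius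
  `hH` and `hAmp`'s growth letter `e^{N₁(‖h₀‖ + ϱ⋆‖w‖)}` are READ AT `ϱ⋆` (not eliminable, as in N0m's own ϱ-free ENDs and S25–S29 §1).
* §2 on pv22's tori (`D := tsys 4 N`, `G := tgeometry 4 N`; `Dk := tsys 4 M`, `Gk := tgeometry 4 M`; all `Geometry` fields PROVED there;
  constants LOCATED AS NUMERALS by N0o `torus_consts` + S24 `K₀_four` at BOTH scales: ν = 9, κ₀ = 64·log 162, c₁ = 64,
  K₀ = `B12TreeDecay.K₀ 64 8`; (2.27)'s `c = 5` through N0s's `hb` at `b₅ = 5·r₁`): `count_coveringFamilies_torus` (N0s §2's count ONCE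
  at `Gk := tgeometry 4 M` for ANY step system `D` — (2.29)'s clauses read `64·log 162 + 1 ≤ δκ`, `e·K₀(64,8)·64·α₆ ≤ 1`; `foot`∕`hmono`
  DISPLAYED; (E′) one `example`: under the SAME clauses (2.29) is pv22's cite-tagged `TreeLengthTorus.ineq229_torus_unit 4 M`),
  `attachedPart_locE_le_of_coresAt_pencil_families_torus` (N0s §4 ONCE with BOTH sockets on tori — NO geometry hypothesis at
  either scale, general ϱ) and `attachedPart_locE_le_of_coresAt_pencil_families_printClause_three_torus` (§1 ONCE on the tori — NO
  geometry hypothesis, NO radius binder).  Conclusions LITERALLY the crew currency `4·(e·9·64·K₀(64,8)²)·A₁·e^{−r₁·torusTreeLen X₀}`.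
* §3 one `example` — THE COMMUTING SQUARE IN KERNEL: §2's families torus face IS PART 1's count-split torus face
  `attachedPart_locE_le_of_coresAt_pencil_count_torus` at the table-blind majorant `maj Z 𝐃 := Π_{Y∈𝐃} α₆e^{−δκ·torusTreeLen Y}·
  e^{−R(torusTreeLen Y + 5)}` with `hCount := count_coveringFamilies_torus` (N0s §4's own proof transplanted to the tori:
  families-then-torus = torus-then-families) — NO new inequality.
WHAT STAYS DISPLAYED (binders, by name; NOTHING instantiated on Bałaban's densities): the room `hroom`; the operator conditions
`hm`∕`hN`∕`hq`; the class radii `hO`∕`hH`; (B1b)'s residue `terms`∕`emb`∕`hscale`∕`hact` and `hterms` (the terms of `Z` ARE covering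
families of `(foot Z).1` — an identification, (B1b) READING) with `foot`∕`hmono` ((2.36) KIND, factor 1 ≤ the tree's repaired `L∕a_L`,
GAPS G-B13-09R); (B3-amp) `hAmp` at the per-family majorant `Π_{Y∈𝐃} α₆e^{−δκ d_k Y}·e^{−R(d_k Y + 5)}` — THE place where the dressed
table radius enters (print's (2.15)∕(2.18) mechanism with `e^{N₁R₀}` read at the DRESSED level, p. 18's clause KIND at `C₃(E₀ + D₀)` —
NOT asserted); `hA₀`, `hA₁` (`0 < A₁`, `A₁ ≤ A₀` for the ϱ-free forms), `hr₁`, `hα₆`; and the located clauses «κ large»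
`r₁ + 2·(64·log 162) + 2 ≤ R` ∕ `64·log 162 + 1 ≤ δκ`, «ε₁ small» in one of the SHAPES `(A₀ + ϱA₁)·E ≤ 1` ∕ `3·A₀·E ≤ 1`,
`E = e^{5r₁+1}·K₀(64,8)·9·64`, «α₆ small» `e·K₀(64,8)·64·α₆ ≤ 1` ((B5): the SHAPES and the factor `3` are the owner's arithmetic consumed
BY NAME; their standing against print's NUMBERS — δ, κ, α₆ of [Balaban1988RGII] pp. 7–8 ∕ p. 18 — is NOT asserted).  (B4) is discharged
BY NAME on pv22's CONSTRUCTED torus geometries; the identification of `tsys 4 N` ∕ `tsys 4 M` ∕ `torusTreeLen` with Bałaban's 𝐃_{k+1} ∕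
𝐃_k ∕ d_{k+1} ∕ d_k (and of WHICH `M` is the scale-`k` torus) is pv22's READING (DIVERGENCE D-pv22.3), not asserted here — statements
about typed SHAPES; no wall item moves; the wall line (v1.7 of record, T4-DAG v43) does NOT move; R-t4r2-Q2 NOT met thereby.
WORDING OF RECORD (typer R-T124 (ii), crew row S34 ∕ DAG N29zze, X-read X149): S29's wording (R-T113 (iii-d)(g)) + «N0s's count-split and
families ENDs re-socketed BY NAME; (B3-count) for the 𝐃-step is b13's PROVED (2.29) on pv22's CONSTRUCTED `tgeometry 4 M` — whether print's
δ, κ, α₆ meet the located numerals is NOT asserted; WHICH `M` is the scale-k torus is pv22's READING (D-pv22.3)» + the typer's rider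
«`foot`∕`hmono` are DISPLAYED binders — the L-refinement between the two tori is NOT constructed here».
HONEST FRAMING.  Kernel bookkeeping; the cores ∕ covering families are the cell's typed FORMAT of (2.14) and of the 𝐃-resummation index,
NOT Bałaban's functions; (B3-count) for the 𝐃-step is b13's PROVED (2.29) BY NAME ([folklore] combinatorics of a finite catalogue under
pv22's PROVED (1.26)∕volume fields); printed loci ([Balaban1988RGII] (2.14) p. 15, (2.18) p. 16, p. 17, (1.26) p. 8, (2.27)∕(2.29) p. 18,
(2.36) p. 19, (2.38) p. 20; [Balaban1987RGI] p. 257) are TYPE ∕ CONTEXT through the imported cite-tagged Literature modules,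
re-asserted nowhere; ABSOLUTE RULE honoured ([folklore] kernel lemmas only).  NE1′ ⇐ the named binders — NOT printed, NOT proved; 0
leaves instantiated on Bałaban's densities; spine PROVED 0∕9; count 9 unchanged.  Rung (B)+1 on ONE finite four-torus — NOT infinite
volume, NOT a mass gap, NOT OS on ℝ⁴, NOT Clay.  HONEST DEPENDENCY: continuum YM on T⁴ ⇐ BetaPertH ∧ nine spine estimates (0/9
proved); BetaPertH ⇐ (D1) ∧ (D4) ∧ CAP+tail; G-an2-4 gates asym, D1 and NE2/3/4.
-/
noncomputable section

namespace Summit.QuantumFields.BalabanUV.T4Continuum.NE1p.DressedSmallFieldCoveringFamiliesFaces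

open Metric Set Complex MeasureTheory
open scoped BigOperators
open Literature.MathematicalPhysics.QuantumFieldTheory.Balaban1983to89 (LocDomainSys)
open Literature.MathematicalPhysics.QuantumFieldTheory.Balaban1983to89.T4OutputRate (Carriers)
open Literature.MathematicalPhysics.QuantumFieldTheory.Balaban1983to89.B13Resummation (locE Geometry)
open Literature.MathematicalPhysics.QuantumFieldTheory.Balaban1983to89.B13FamilySum (coveringFamilies Ineq229)
open Literature.MathematicalPhysics.QuantumFieldTheory.Balaban1983to89.TreeLengthTorus (tsys torusTreeLen ineq229_torus_unit)
open Literature.MathematicalPhysics.QuantumFieldTheory.Balaban1983to89.TreeLengthTorusGeometry (TTouch tgeometry)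
open Literature.MathematicalPhysics.QuantumFieldTheory.Balaban1983to89.B12TreeDecay (K₀)
open Summit.QuantumFields.BalabanUV.T4Continuum.B13HistMeasurable (MeasPotFrame B13HistM)
open Summit.QuantumFields.BalabanUV.T4Continuum.B13TermParamGaussianBi (BiCore)
open Summit.QuantumFields.BalabanUV.T4Continuum.NE1p.DressedSmallFieldFamilyCount (count_coveringFamilies_geometry
  attachedPart_locE_le_of_coresAt_pencil_families)
open Summit.QuantumFields.BalabanUV.T4Continuum.NE1p.DressedSmallFieldFamilyCountFaces
  (attachedPart_locE_le_of_coresAt_pencil_count_torus)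
open Summit.QuantumFields.BalabanUV.T4Continuum.NE1p.DressedSmallFieldInduction (two_le_pencilRadius
  intercept_le_pencilRadius_mul pencilClause_of_printClause_three)
open Summit.QuantumFields.BalabanUV.T4Continuum.NE1p.DressedSmallFieldGeometry (torus_consts)
open Summit.QuantumFields.BalabanUV.T4Continuum.NE1p.DressedSmallFieldGeometryFaces (K₀_four)

/-! ## §1 THE ϱ-FREE FORM OF THE FAMILIES END OVER A `B13Resummation.Geometry` — N0m §4∕§4b's arithmetic BY NAME (sharp room 3) -/

section OfGeometry

variable {C : Carriers} {P : MeasPotFrame C} {Op : Type*} [NormedAddCommGroup Op] [NormedSpace ℂ Op] {Dk : LocDomainSys}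
  {𝒴 : ℕ → Finset Dk.Dom → Type*} {dom : ∀ k i, 𝒴 k i → C.Dom} {β : ℕ → Finset Dk.Dom → Type*}
  [∀ k i, MeasurableSpace (β k i)] {α : ℕ → Finset Dk.Dom → Type*} [∀ k i, NormedAddCommGroup (α k i)]
  [∀ k i, InnerProductSpace ℝ (α k i)] [∀ k i, FiniteDimensional ℝ (α k i)] [∀ k i, MeasurableSpace (α k i)]
  [∀ k i, BorelSpace (α k i)]
variable (D : LocDomainSys) {Cube : Type} [DecidableEq Cube] (G : Geometry D Cube) {CubeK : Type} [DecidableEq CubeK]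
  (Gk : Geometry Dk CubeK)

open Classical in
/-- **THE FAMILIES END UNDER PRINT'S CLAUSE WITH THE SHARP FACTOR-3 ROOM — NO RADIUS BINDER** (kernel; N0s §4
`attachedPart_locE_le_of_coresAt_pencil_families` ONCE BY NAME at the pencil radius `ϱ⋆ := max 2 (A₀/A₁)`, its `hϱ` ∕ `hϱA` ∕ `hsmall`
SUPPLIED by N0m §4∕§4b's `two_le_pencilRadius` ∕ `intercept_le_pencilRadius_mul` ∕ `pencilClause_of_printClause_three` BY NAME): for a
live attached slope `0 < A₁ ≤ A₀`, «κ large» `hrate`, «ε₁ small AT THE UNDRESSED CONSTANT with the sharp factor-3 room»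
`h3 : 3·A₀·(e^{b₅+1}·G.K₀·G.ν·G.c₁) ≤ 1`, the scale-`k` socket `Gk` with (2.29)'s clauses `hκ` ∕ `h229`, the footprint reading
`foot`∕`hmono`∕`hterms` and the per-family AMPLITUDE `hAmp` READ AT `ϱ⋆` (as is the class radius `hH`) — the other binders N0s's
verbatim — the attached part of the families activity is `≤ 4·(e·G.ν·G.c₁·G.K₀²)·A₁·e^{−r₁ d(X₀)}`. [folklore] -/
theorem attachedPart_locE_le_of_coresAt_pencil_families_printClause_three {W : Set (ℕ → ℝ)}
    {ctr : ℕ → (ℕ → ℝ) → C.BgB → Op × B13HistM P} {ROp RHist R' : ℕ → ℝ}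
    (𝔊 : ∀ k i, C.Dom → BiCore P (dom k i) Op (β k i) (α k i)) {mq bq N₀ : ℕ → Finset Dk.Dom → C.Dom → ℝ}
    (hroom : ∀ k, ROp k < R' k)
    (hm : ∀ k, ∀ g ∈ W, ∀ (U : C.BgB) (X : C.Dom), C.scale X = k → ∀ i, 0 < mq k i X)
    (hN : ∀ k, ∀ g ∈ W, ∀ (U : C.BgB) (X : C.Dom), C.scale X = k → ∀ i,
      (∀ o ∈ ball (ctr k g U).1 (R' k), AEStronglyMeasurable ((𝔊 k i X).N o) (𝔊 k i X).lam) ∧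
      (∀ p, DifferentiableOn ℂ (fun o => (𝔊 k i X).N o p) (ball (ctr k g U).1 (R' k))) ∧
      (∀ o ∈ ball (ctr k g U).1 (R' k), ∀ p, ‖(𝔊 k i X).N o p‖ ≤ N₀ k i X))
    (hq : ∀ k, ∀ g ∈ W, ∀ (U : C.BgB) (X : C.Dom), C.scale X = k → ∀ i,
      (∀ o ∈ ball (ctr k g U).1 (R' k),
        AEStronglyMeasurable (Function.uncurry ((𝔊 k i X).q o)) ((𝔊 k i X).lam.prod volume)) ∧
      (∀ p v, DifferentiableOn ℂ (fun o => (𝔊 k i X).q o p v) (ball (ctr k g U).1 (R' k))) ∧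
      (∀ o ∈ ball (ctr k g U).1 (R' k), ∀ p v, mq k i X * ‖v‖ ^ 2 - bq k i X ≤ ((𝔊 k i X).q o p v).re))
    {k : ℕ} {g : ℕ → ℝ} (hg : g ∈ W) {U : C.BgB} {o : Op} {h₀ w : B13HistM P} {A₀ A₁ : ℝ}
    (hO : ‖o - (ctr k g U).1‖ ≤ ROp k) (hH : ‖h₀ - (ctr k g U).2‖ + max 2 (A₀ / A₁) * ‖w‖ ≤ RHist k)
    {emb : D.Dom → C.Dom} (hscale : ∀ Z, C.scale (emb Z) = k) {terms : D.Dom → Finset (Finset Dk.Dom)}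
    {act : ℂ → D.Dom → ℂ}
    (hact : ∀ s ∈ ball (0 : ℂ) (max 2 (A₀ / A₁)), ∀ Z, act s Z = ∑ i ∈ terms Z, (𝔊 k i (emb Z)).termAt o (h₀ + s • w))
    {R r₁ b₅ : ℝ} {X₀ : D.Dom} (hA₀ : 0 ≤ A₀) (hA₁ : 0 < A₁) (hle : A₁ ≤ A₀) (hr₁ : 0 ≤ r₁) (hb : r₁ * 5 ≤ b₅)
    (hrate : r₁ + 2 * G.κ₀ + 2 ≤ R) (h3 : 3 * A₀ * (Real.exp (b₅ + 1) * G.K₀ * G.ν * G.c₁) ≤ 1)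
    (foot : D.Dom → Dk.Dom) (hmono : ∀ Z, D.dj Z ≤ Dk.dj (foot Z)) {δ κ α₆ : ℝ} (hα₆ : 0 ≤ α₆)
    (hκ : Gk.κ₀ + 1 ≤ δ * κ) (h229 : Real.exp 1 * Gk.K₀ * Gk.c₁ * α₆ ≤ 1)
    (hterms : ∀ Z, terms Z ⊆ coveringFamilies Finset.univ Gk.cubes (Gk.cubes (foot Z)))
    (hAmp : ∀ Z, G.cubes Z ⊆ G.cubes X₀ → ∀ Df ∈ terms Z,
      (𝔊 k Df (emb Z)).lam.real univ * ((𝔊 k Df (emb Z)).wB * N₀ k Df (emb Z) * Real.exp (bq k Df (emb Z))) *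
          (Real.pi / (mq k Df (emb Z) / 2)) ^ (Module.finrank ℝ (α k Df) / 2 : ℝ) *
        Real.exp ((𝔊 k Df (emb Z)).N₁ * (‖h₀‖ + max 2 (A₀ / A₁) * ‖w‖)) ≤
      (A₀ + max 2 (A₀ / A₁) * A₁) *
        ∏ Y ∈ Df, (α₆ * Real.exp (-(δ * κ * Dk.dj Y)) * Real.exp (-(R * (Dk.dj Y + 5))))) :
    ‖locE G.ι G.cubes (act 1) (G.cubes X₀) - locE G.ι G.cubes (act 0) (G.cubes X₀)‖ ≤
      4 * (Real.exp 1 * G.ν * G.c₁ * G.K₀ ^ 2) * A₁ * Real.exp (-(r₁ * D.dj X₀)) := by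
  have hE : 0 ≤ Real.exp (b₅ + 1) * G.K₀ * G.ν * G.c₁ :=
    mul_nonneg (mul_nonneg (mul_nonneg (Real.exp_nonneg _) G.K₀_nonneg) G.ν_nonneg) G.c₁_nonneg
  have hsmall : (A₀ + max 2 (A₀ / A₁) * A₁) * Real.exp (b₅ + 1) * G.K₀ * G.ν * G.c₁ ≤ 1 := by
    simpa only [mul_assoc] using pencilClause_of_printClause_three hA₁ hle hE h3
  exact attachedPart_locE_le_of_coresAt_pencil_families D G Gk 𝔊 hroom hm hN hq hg hO hH hscale hact hA₀ hA₁.le hr₁ hb hrate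
    hsmall foot hmono hα₆ hκ h229 hterms hAmp (two_le_pencilRadius A₀ A₁) (intercept_le_pencilRadius_mul hA₁)

end OfGeometry

/-! ## §2 ON THE TORI OF THE PAPERS (pv22's `tgeometry 4 N` ∕ `tgeometry 4 M`): NO geometry hypothesis at either scale, clauses
LOCATED AS NUMERALS (S24–S29 §2 pattern: ν = 9, κ₀ = 64·log 162, c₁ = 64, K₀ = `B12TreeDecay.K₀ 64 8`, (2.27)'s `c = 5`, `b₅ = 5·r₁`) -/

section Torus

variable {N : ℕ} [NeZero N] {M : ℕ} [NeZero M]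

/-- **THE TABLE-BLIND COUNT OVER COVERING FAMILIES OF TORUS DOMAINS — NO GEOMETRY HYPOTHESIS** (kernel; N0s §2
`count_coveringFamilies_geometry` ONCE at `Gk := tgeometry 4 M`, its (1.26)∕volume∕(2.27) fields PROVED by pv22, constants located by
N0o `torus_consts` + S24 `K₀_four`): for ANY step system `D`, footprint map `foot : D.Dom → (tsys 4 M).Dom` with `d(Z) ≤ torusTreeLen
(foot Z)` (`hmono`, (2.36) KIND), (2.29)'s order-of-choice clauses AS LOCATED NUMERALS `64·log 162 + 1 ≤ δκ` («κ sufficiently large»)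
and `e·K₀(64,8)·64·α₆ ≤ 1` («α₆ sufficiently small»), `R ≥ 0`, and ANY sub-collection `terms` of the families of torus domains covering
`(foot Z).1` exactly: `Σ_{Df ∈ terms} Π_{Y∈Df} (α₆ e^{−δκ·torusTreeLen Y} · e^{−R(torusTreeLen Y + 5)}) ≤ e^{−R d(Z)}`. [folklore] -/
theorem count_coveringFamilies_torus {D : LocDomainSys} (foot : D.Dom → (tsys 4 M).Dom)
    (hmono : ∀ Z, D.dj Z ≤ torusTreeLen (foot Z).1) {δ κ α₆ R : ℝ} (hα₆ : 0 ≤ α₆)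
    (hκ : 64 * Real.log 162 + 1 ≤ δ * κ) (h229 : Real.exp 1 * K₀ 64 8 * 64 * α₆ ≤ 1) (hR : 0 ≤ R) (Z : D.Dom)
    {terms : Finset (Finset (tsys 4 M).Dom)}
    (hterms : terms ⊆ coveringFamilies Finset.univ (fun Y : (tsys 4 M).Dom => Y.1) (foot Z).1) :
    ∑ Df ∈ terms, ∏ Y ∈ Df, (α₆ * Real.exp (-(δ * κ * torusTreeLen Y.1)) * Real.exp (-(R * (torusTreeLen Y.1 + 5)))) ≤
      Real.exp (-(R * D.dj Z)) := by
  obtain ⟨-, hκ₀, hc⟩ := torus_consts M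
  have hK₀ := K₀_four (N := M)
  exact count_coveringFamilies_geometry (tgeometry 4 M) foot hmono hα₆ (by rw [hκ₀]; exact hκ)
    (by rw [hK₀, hc]; exact h229) hR Z hterms

/-- (E′) CONSISTENCY WITH pv22's OWN LOCATED (2.29): under the SAME two located clauses, (2.29) for the families of scale-`k` torus
domains is ALSO pv22's cite-tagged `TreeLengthTorus.ineq229_torus_unit 4 M` (d = 4; its clauses `kappa₀ (4·2⁴) (2·4) + 1 ≤ δκ`,
`e·K₀(4·2⁴, 2·4)·(4·2⁴)·α₆ ≤ 1` ARE `torus_consts` ∕ `K₀_four`'s numerals) — the count above consumes nothing beyond it. [folklore] -/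
example {δ κ α₆ : ℝ} (hα₆ : 0 ≤ α₆) (hκ : 64 * Real.log 162 + 1 ≤ δ * κ) (h229 : Real.exp 1 * K₀ 64 8 * 64 * α₆ ≤ 1) :
    Ineq229 (Finset.univ : Finset (tsys 4 M).Dom) (fun Y : (tsys 4 M).Dom => Y.1) (tsys 4 M).dj α₆ (δ * κ) := by
  obtain ⟨-, hκ₀, hc⟩ := torus_consts M
  have hK₀ := K₀_four (N := M)
  have h1 : (tgeometry 4 M).κ₀ + 1 ≤ δ * κ := by rw [hκ₀]; exact hκ
  have h2 : Real.exp 1 * (tgeometry 4 M).K₀ * (tgeometry 4 M).c₁ * α₆ ≤ 1 := by rw [hK₀, hc]; exact h229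
  exact ineq229_torus_unit 4 M δ κ α₆ hα₆ h1 h2

section Families

variable {C : Carriers} {P : MeasPotFrame C} {Op : Type*} [NormedAddCommGroup Op] [NormedSpace ℂ Op]
  {𝒴 : ℕ → Finset (tsys 4 M).Dom → Type*} {dom : ∀ k i, 𝒴 k i → C.Dom} {β : ℕ → Finset (tsys 4 M).Dom → Type*}
  [∀ k i, MeasurableSpace (β k i)] {α : ℕ → Finset (tsys 4 M).Dom → Type*} [∀ k i, NormedAddCommGroup (α k i)]
  [∀ k i, InnerProductSpace ℝ (α k i)] [∀ k i, FiniteDimensional ℝ (α k i)] [∀ k i, MeasurableSpace (α k i)]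
  [∀ k i, BorelSpace (α k i)]

open Classical in
/-- **THE FAMILIES END WITH BOTH SOCKETS ON TORI — NO GEOMETRY HYPOTHESIS AT EITHER SCALE** (kernel; N0s §4
`attachedPart_locE_le_of_coresAt_pencil_families` ONCE at `D := tsys 4 N`, `G := tgeometry 4 N`, `Dk := tsys 4 M`, `Gk := tgeometry 4 M`,
constants located at both scales): cores `𝔊 k 𝐃 X` indexed by families `𝐃` of scale-`k` torus domains, the operator letters, room,
pencil radii, indexing `hact`, the located step clauses, N0m's `hϱ`∕`hϱA`; of (B3) the DISPLAYED `hterms` (the terms of `Z` ARE covering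
families of `(foot Z).1` — (B1b) READING, with `foot`∕`hmono` (2.36) KIND) and the per-family AMPLITUDE `hAmp` at the torus letters, and
(2.29)'s clauses AS LOCATED NUMERALS `64·log 162 + 1 ≤ δκ`, `e·K₀(64,8)·64·α₆ ≤ 1` — (B3-count) DISCHARGED inside N0s by b13's PROVED
(2.29) on pv22's CONSTRUCTED `tgeometry 4 M`: the attached part on a torus domain `X₀` is `≤ 4·(e·9·64·K₀(64,8)²)·A₁·e^{−r₁·torusTreeLen X₀}`.
[folklore] -/
theorem attachedPart_locE_le_of_coresAt_pencil_families_torus {W : Set (ℕ → ℝ)}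
    {ctr : ℕ → (ℕ → ℝ) → C.BgB → Op × B13HistM P} {ROp RHist R' : ℕ → ℝ}
    (𝔊 : ∀ k i, C.Dom → BiCore P (dom k i) Op (β k i) (α k i)) {mq bq N₀ : ℕ → Finset (tsys 4 M).Dom → C.Dom → ℝ}
    (hroom : ∀ k, ROp k < R' k)
    (hm : ∀ k, ∀ g ∈ W, ∀ (U : C.BgB) (X : C.Dom), C.scale X = k → ∀ i, 0 < mq k i X)
    (hN : ∀ k, ∀ g ∈ W, ∀ (U : C.BgB) (X : C.Dom), C.scale X = k → ∀ i,
      (∀ o ∈ ball (ctr k g U).1 (R' k), AEStronglyMeasurable ((𝔊 k i X).N o) (𝔊 k i X).lam) ∧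
      (∀ p, DifferentiableOn ℂ (fun o => (𝔊 k i X).N o p) (ball (ctr k g U).1 (R' k))) ∧
      (∀ o ∈ ball (ctr k g U).1 (R' k), ∀ p, ‖(𝔊 k i X).N o p‖ ≤ N₀ k i X))
    (hq : ∀ k, ∀ g ∈ W, ∀ (U : C.BgB) (X : C.Dom), C.scale X = k → ∀ i,
      (∀ o ∈ ball (ctr k g U).1 (R' k),
        AEStronglyMeasurable (Function.uncurry ((𝔊 k i X).q o)) ((𝔊 k i X).lam.prod volume)) ∧
      (∀ p v, DifferentiableOn ℂ (fun o => (𝔊 k i X).q o p v) (ball (ctr k g U).1 (R' k))) ∧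
      (∀ o ∈ ball (ctr k g U).1 (R' k), ∀ p v, mq k i X * ‖v‖ ^ 2 - bq k i X ≤ ((𝔊 k i X).q o p v).re))
    {k : ℕ} {g : ℕ → ℝ} (hg : g ∈ W) {U : C.BgB} {o : Op} {h₀ w : B13HistM P} {ϱ : ℝ}
    (hO : ‖o - (ctr k g U).1‖ ≤ ROp k) (hH : ‖h₀ - (ctr k g U).2‖ + ϱ * ‖w‖ ≤ RHist k)
    {emb : (tsys 4 N).Dom → C.Dom} (hscale : ∀ Z, C.scale (emb Z) = k)
    {terms : (tsys 4 N).Dom → Finset (Finset (tsys 4 M).Dom)} {act : ℂ → (tsys 4 N).Dom → ℂ}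
    (hact : ∀ s ∈ ball (0 : ℂ) ϱ, ∀ Z, act s Z = ∑ i ∈ terms Z, (𝔊 k i (emb Z)).termAt o (h₀ + s • w))
    {A₀ A₁ R r₁ : ℝ} (X₀ : (tsys 4 N).Dom) (hA₀ : 0 ≤ A₀) (hA₁ : 0 ≤ A₁) (hr₁ : 0 ≤ r₁)
    (hrate : r₁ + 2 * (64 * Real.log 162) + 2 ≤ R)
    (hsmall : (A₀ + ϱ * A₁) * Real.exp (5 * r₁ + 1) * K₀ 64 8 * 9 * 64 ≤ 1)
    (foot : (tsys 4 N).Dom → (tsys 4 M).Dom) (hmono : ∀ Z, torusTreeLen Z.1 ≤ torusTreeLen (foot Z).1) {δ κ α₆ : ℝ}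
    (hα₆ : 0 ≤ α₆) (hκ : 64 * Real.log 162 + 1 ≤ δ * κ) (h229 : Real.exp 1 * K₀ 64 8 * 64 * α₆ ≤ 1)
    (hterms : ∀ Z, terms Z ⊆ coveringFamilies Finset.univ (fun Y : (tsys 4 M).Dom => Y.1) (foot Z).1)
    (hAmp : ∀ Z : (tsys 4 N).Dom, Z.1 ⊆ X₀.1 → ∀ Df ∈ terms Z,
      (𝔊 k Df (emb Z)).lam.real univ * ((𝔊 k Df (emb Z)).wB * N₀ k Df (emb Z) * Real.exp (bq k Df (emb Z))) *
          (Real.pi / (mq k Df (emb Z) / 2)) ^ (Module.finrank ℝ (α k Df) / 2 : ℝ) *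
        Real.exp ((𝔊 k Df (emb Z)).N₁ * (‖h₀‖ + ϱ * ‖w‖)) ≤
      (A₀ + ϱ * A₁) *
        ∏ Y ∈ Df, (α₆ * Real.exp (-(δ * κ * torusTreeLen Y.1)) * Real.exp (-(R * (torusTreeLen Y.1 + 5)))))
    (hϱ : 2 ≤ ϱ) (hϱA : A₀ ≤ ϱ * A₁) :
    ‖locE (TTouch (d := 4) (N := N)) (fun Z : (tsys 4 N).Dom => Z.1) (act 1) X₀.1 -
        locE (TTouch (d := 4) (N := N)) (fun Z : (tsys 4 N).Dom => Z.1) (act 0) X₀.1‖ ≤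
      4 * (Real.exp 1 * 9 * 64 * K₀ 64 8 ^ 2) * A₁ * Real.exp (-(r₁ * torusTreeLen X₀.1)) := by
  obtain ⟨hν, hκ₀, hc⟩ := torus_consts N
  obtain ⟨-, hκ₀M, hcM⟩ := torus_consts M
  have hK₀ := K₀_four (N := N)
  have hK₀M := K₀_four (N := M)
  have h := attachedPart_locE_le_of_coresAt_pencil_families (tsys 4 N) (tgeometry 4 N) (tgeometry 4 M) 𝔊 hroom hm hN hq hg hO
    hH hscale hact (R := R) (b₅ := 5 * r₁) (X₀ := X₀) hA₀ hA₁ hr₁ (le_of_eq (by ring)) (by rw [hκ₀]; exact hrate)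
    (by rw [hK₀, hν, hc]; exact hsmall) foot hmono hα₆ (by rw [hκ₀M]; exact hκ) (by rw [hK₀M, hcM]; exact h229) hterms
    hAmp hϱ hϱA
  rw [hν, hc, hK₀] at h
  exact h

open Classical in
/-- **THE FAMILIES END ON THE TORI, ϱ-FREE — NO GEOMETRY HYPOTHESIS, NO RADIUS BINDER** (kernel; §1's
`attachedPart_locE_le_of_coresAt_pencil_families_printClause_three` at `tgeometry 4 N` ∕ `tgeometry 4 M`, constants located): live slope
`0 < A₁ ≤ A₀`, «κ large» `r₁ + 2·(64·log 162) + 2 ≤ R` and `64·log 162 + 1 ≤ δκ`, «ε₁ small with the sharp factor-3 room»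
`3·A₀·(e^{5r₁+1}·K₀(64,8)·9·64) ≤ 1`, «α₆ small» `e·K₀(64,8)·64·α₆ ≤ 1`, the class radius `hH` and `hAmp`'s growth letter READ AT
`ϱ⋆ = max 2 (A₀/A₁)` ⇒ the same located bound. [folklore] -/
theorem attachedPart_locE_le_of_coresAt_pencil_families_printClause_three_torus {W : Set (ℕ → ℝ)}
    {ctr : ℕ → (ℕ → ℝ) → C.BgB → Op × B13HistM P} {ROp RHist R' : ℕ → ℝ}
    (𝔊 : ∀ k i, C.Dom → BiCore P (dom k i) Op (β k i) (α k i)) {mq bq N₀ : ℕ → Finset (tsys 4 M).Dom → C.Dom → ℝ}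
    (hroom : ∀ k, ROp k < R' k)
    (hm : ∀ k, ∀ g ∈ W, ∀ (U : C.BgB) (X : C.Dom), C.scale X = k → ∀ i, 0 < mq k i X)
    (hN : ∀ k, ∀ g ∈ W, ∀ (U : C.BgB) (X : C.Dom), C.scale X = k → ∀ i,
      (∀ o ∈ ball (ctr k g U).1 (R' k), AEStronglyMeasurable ((𝔊 k i X).N o) (𝔊 k i X).lam) ∧
      (∀ p, DifferentiableOn ℂ (fun o => (𝔊 k i X).N o p) (ball (ctr k g U).1 (R' k))) ∧
      (∀ o ∈ ball (ctr k g U).1 (R' k), ∀ p, ‖(𝔊 k i X).N o p‖ ≤ N₀ k i X))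
    (hq : ∀ k, ∀ g ∈ W, ∀ (U : C.BgB) (X : C.Dom), C.scale X = k → ∀ i,
      (∀ o ∈ ball (ctr k g U).1 (R' k),
        AEStronglyMeasurable (Function.uncurry ((𝔊 k i X).q o)) ((𝔊 k i X).lam.prod volume)) ∧
      (∀ p v, DifferentiableOn ℂ (fun o => (𝔊 k i X).q o p v) (ball (ctr k g U).1 (R' k))) ∧
      (∀ o ∈ ball (ctr k g U).1 (R' k), ∀ p v, mq k i X * ‖v‖ ^ 2 - bq k i X ≤ ((𝔊 k i X).q o p v).re))
    {k : ℕ} {g : ℕ → ℝ} (hg : g ∈ W) {U : C.BgB} {o : Op} {h₀ w : B13HistM P} {A₀ A₁ : ℝ}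
    (hO : ‖o - (ctr k g U).1‖ ≤ ROp k) (hH : ‖h₀ - (ctr k g U).2‖ + max 2 (A₀ / A₁) * ‖w‖ ≤ RHist k)
    {emb : (tsys 4 N).Dom → C.Dom} (hscale : ∀ Z, C.scale (emb Z) = k)
    {terms : (tsys 4 N).Dom → Finset (Finset (tsys 4 M).Dom)} {act : ℂ → (tsys 4 N).Dom → ℂ}
    (hact : ∀ s ∈ ball (0 : ℂ) (max 2 (A₀ / A₁)), ∀ Z, act s Z = ∑ i ∈ terms Z, (𝔊 k i (emb Z)).termAt o (h₀ + s • w))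
    {R r₁ : ℝ} (X₀ : (tsys 4 N).Dom) (hA₀ : 0 ≤ A₀) (hA₁ : 0 < A₁) (hle : A₁ ≤ A₀) (hr₁ : 0 ≤ r₁)
    (hrate : r₁ + 2 * (64 * Real.log 162) + 2 ≤ R) (h3 : 3 * A₀ * (Real.exp (5 * r₁ + 1) * K₀ 64 8 * 9 * 64) ≤ 1)
    (foot : (tsys 4 N).Dom → (tsys 4 M).Dom) (hmono : ∀ Z, torusTreeLen Z.1 ≤ torusTreeLen (foot Z).1) {δ κ α₆ : ℝ}
    (hα₆ : 0 ≤ α₆) (hκ : 64 * Real.log 162 + 1 ≤ δ * κ) (h229 : Real.exp 1 * K₀ 64 8 * 64 * α₆ ≤ 1)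
    (hterms : ∀ Z, terms Z ⊆ coveringFamilies Finset.univ (fun Y : (tsys 4 M).Dom => Y.1) (foot Z).1)
    (hAmp : ∀ Z : (tsys 4 N).Dom, Z.1 ⊆ X₀.1 → ∀ Df ∈ terms Z,
      (𝔊 k Df (emb Z)).lam.real univ * ((𝔊 k Df (emb Z)).wB * N₀ k Df (emb Z) * Real.exp (bq k Df (emb Z))) *
          (Real.pi / (mq k Df (emb Z) / 2)) ^ (Module.finrank ℝ (α k Df) / 2 : ℝ) *
        Real.exp ((𝔊 k Df (emb Z)).N₁ * (‖h₀‖ + max 2 (A₀ / A₁) * ‖w‖)) ≤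
      (A₀ + max 2 (A₀ / A₁) * A₁) *
        ∏ Y ∈ Df, (α₆ * Real.exp (-(δ * κ * torusTreeLen Y.1)) * Real.exp (-(R * (torusTreeLen Y.1 + 5))))) :
    ‖locE (TTouch (d := 4) (N := N)) (fun Z : (tsys 4 N).Dom => Z.1) (act 1) X₀.1 -
        locE (TTouch (d := 4) (N := N)) (fun Z : (tsys 4 N).Dom => Z.1) (act 0) X₀.1‖ ≤
      4 * (Real.exp 1 * 9 * 64 * K₀ 64 8 ^ 2) * A₁ * Real.exp (-(r₁ * torusTreeLen X₀.1)) := by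
  obtain ⟨hν, hκ₀, hc⟩ := torus_consts N
  obtain ⟨-, hκ₀M, hcM⟩ := torus_consts M
  have hK₀ := K₀_four (N := N)
  have hK₀M := K₀_four (N := M)
  have h := attachedPart_locE_le_of_coresAt_pencil_families_printClause_three (tsys 4 N) (tgeometry 4 N) (tgeometry 4 M) 𝔊
    hroom hm hN hq hg hO hH hscale hact (R := R) (b₅ := 5 * r₁) (X₀ := X₀) hA₀ hA₁ hle hr₁ (le_of_eq (by ring))
    (by rw [hκ₀]; exact hrate) (by rw [hK₀, hν, hc]; exact h3) foot hmono hα₆ (by rw [hκ₀M]; exact hκ)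
    (by rw [hK₀M, hcM]; exact h229) hterms hAmp
  rw [hν, hc, hK₀] at h
  exact h

/-! ## §3 Consistency — the families ∘ torus square commutes, in kernel -/

open Classical in
/-- (E) THE COMMUTING SQUARE: §2's `attachedPart_locE_le_of_coresAt_pencil_families_torus` IS PART 1's count-split torus face
`DressedSmallFieldFamilyCountFaces.attachedPart_locE_le_of_coresAt_pencil_count_torus` at the table-blind majorant
`maj Z 𝐃 := Π_{Y∈𝐃} α₆e^{−δκ·torusTreeLen Y}·e^{−R(torusTreeLen Y + 5)}` with `hCount` SUPPLIED by §2's `count_coveringFamilies_torus`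
(`R ≥ 0` from the located «κ large» clause) — N0s §4's own proof transplanted to the tori (families-then-torus = torus-then-families).
This file asserts NO new inequality. [folklore] -/
example {W : Set (ℕ → ℝ)}
    {ctr : ℕ → (ℕ → ℝ) → C.BgB → Op × B13HistM P} {ROp RHist R' : ℕ → ℝ}
    (𝔊 : ∀ k i, C.Dom → BiCore P (dom k i) Op (β k i) (α k i)) {mq bq N₀ : ℕ → Finset (tsys 4 M).Dom → C.Dom → ℝ}
    (hroom : ∀ k, ROp k < R' k)
    (hm : ∀ k, ∀ g ∈ W, ∀ (U : C.BgB) (X : C.Dom), C.scale X = k → ∀ i, 0 < mq k i X)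
    (hN : ∀ k, ∀ g ∈ W, ∀ (U : C.BgB) (X : C.Dom), C.scale X = k → ∀ i,
      (∀ o ∈ ball (ctr k g U).1 (R' k), AEStronglyMeasurable ((𝔊 k i X).N o) (𝔊 k i X).lam) ∧
      (∀ p, DifferentiableOn ℂ (fun o => (𝔊 k i X).N o p) (ball (ctr k g U).1 (R' k))) ∧
      (∀ o ∈ ball (ctr k g U).1 (R' k), ∀ p, ‖(𝔊 k i X).N o p‖ ≤ N₀ k i X))
    (hq : ∀ k, ∀ g ∈ W, ∀ (U : C.BgB) (X : C.Dom), C.scale X = k → ∀ i,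
      (∀ o ∈ ball (ctr k g U).1 (R' k),
        AEStronglyMeasurable (Function.uncurry ((𝔊 k i X).q o)) ((𝔊 k i X).lam.prod volume)) ∧
      (∀ p v, DifferentiableOn ℂ (fun o => (𝔊 k i X).q o p v) (ball (ctr k g U).1 (R' k))) ∧
      (∀ o ∈ ball (ctr k g U).1 (R' k), ∀ p v, mq k i X * ‖v‖ ^ 2 - bq k i X ≤ ((𝔊 k i X).q o p v).re))
    {k : ℕ} {g : ℕ → ℝ} (hg : g ∈ W) {U : C.BgB} {o : Op} {h₀ w : B13HistM P} {ϱ : ℝ}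
    (hO : ‖o - (ctr k g U).1‖ ≤ ROp k) (hH : ‖h₀ - (ctr k g U).2‖ + ϱ * ‖w‖ ≤ RHist k)
    {emb : (tsys 4 N).Dom → C.Dom} (hscale : ∀ Z, C.scale (emb Z) = k)
    {terms : (tsys 4 N).Dom → Finset (Finset (tsys 4 M).Dom)} {act : ℂ → (tsys 4 N).Dom → ℂ}
    (hact : ∀ s ∈ ball (0 : ℂ) ϱ, ∀ Z, act s Z = ∑ i ∈ terms Z, (𝔊 k i (emb Z)).termAt o (h₀ + s • w))
    {A₀ A₁ R r₁ : ℝ} (X₀ : (tsys 4 N).Dom) (hA₀ : 0 ≤ A₀) (hA₁ : 0 ≤ A₁) (hr₁ : 0 ≤ r₁)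
    (hrate : r₁ + 2 * (64 * Real.log 162) + 2 ≤ R)
    (hsmall : (A₀ + ϱ * A₁) * Real.exp (5 * r₁ + 1) * K₀ 64 8 * 9 * 64 ≤ 1)
    (foot : (tsys 4 N).Dom → (tsys 4 M).Dom) (hmono : ∀ Z, torusTreeLen Z.1 ≤ torusTreeLen (foot Z).1) {δ κ α₆ : ℝ}
    (hα₆ : 0 ≤ α₆) (hκ : 64 * Real.log 162 + 1 ≤ δ * κ) (h229 : Real.exp 1 * K₀ 64 8 * 64 * α₆ ≤ 1)
    (hterms : ∀ Z, terms Z ⊆ coveringFamilies Finset.univ (fun Y : (tsys 4 M).Dom => Y.1) (foot Z).1)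
    (hAmp : ∀ Z : (tsys 4 N).Dom, Z.1 ⊆ X₀.1 → ∀ Df ∈ terms Z,
      (𝔊 k Df (emb Z)).lam.real univ * ((𝔊 k Df (emb Z)).wB * N₀ k Df (emb Z) * Real.exp (bq k Df (emb Z))) *
          (Real.pi / (mq k Df (emb Z) / 2)) ^ (Module.finrank ℝ (α k Df) / 2 : ℝ) *
        Real.exp ((𝔊 k Df (emb Z)).N₁ * (‖h₀‖ + ϱ * ‖w‖)) ≤
      (A₀ + ϱ * A₁) *
        ∏ Y ∈ Df, (α₆ * Real.exp (-(δ * κ * torusTreeLen Y.1)) * Real.exp (-(R * (torusTreeLen Y.1 + 5)))))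
    (hϱ : 2 ≤ ϱ) (hϱA : A₀ ≤ ϱ * A₁) :
    ‖locE (TTouch (d := 4) (N := N)) (fun Z : (tsys 4 N).Dom => Z.1) (act 1) X₀.1 -
        locE (TTouch (d := 4) (N := N)) (fun Z : (tsys 4 N).Dom => Z.1) (act 0) X₀.1‖ ≤
      4 * (Real.exp 1 * 9 * 64 * K₀ 64 8 ^ 2) * A₁ * Real.exp (-(r₁ * torusTreeLen X₀.1)) :=
  have hR : 0 ≤ R := by linarith [mul_nonneg (show (0 : ℝ) ≤ 64 by norm_num) (Real.log_nonneg (show (1 : ℝ) ≤ 162 by norm_num))]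
  attachedPart_locE_le_of_coresAt_pencil_count_torus 𝔊 hroom hm hN hq hg hO hH hscale hact X₀ hA₀ hA₁ hr₁ hrate hsmall
    (fun _ Df => ∏ Y ∈ Df, (α₆ * Real.exp (-(δ * κ * torusTreeLen Y.1)) * Real.exp (-(R * (torusTreeLen Y.1 + 5))))) hAmp
    (fun Z _ => count_coveringFamilies_torus foot hmono hα₆ hκ h229 hR Z (hterms Z)) hϱ hϱA

end Families

end Torus

end Summit.QuantumFields.BalabanUV.T4Continuum.NE1p.DressedSmallFieldCoveringFamiliesFaces

end
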